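import Mathlib.RepresentationTheory.Intertwining
import Mathlib.LinearAlgebra.Dual.Lemmas
import HarnessLib

/-!
# Transposition of intertwining maps: `Hom_G(V, W) ≃ Hom_G(W^∨, V^∨)` for reflexive modules

Topic `RepresentationTheory`; namespace `Literature.RepresentationTheory.IntertwiningDual`.  Definitions with bodies and
theorems; Mathlib only; no named fact, no `sorry`.

For representations `ρ : G → GL(V)`, `σ : G → GL(W)` of a group `G` on modules over a commutative ring `k`, the TRANSPOSE
`f ↦ ᵗf` carries an intertwining map `f : V → W` (`f ∘ ρ(g) = σ(g) ∘ f`) to an intertwining map `ᵗf : W^∨ → V^∨` for the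
DUAL (contragredient) representations `σ^∨(g) = ᵗσ(g⁻¹)`, `ρ^∨(g) = ᵗρ(g⁻¹)` (Mathlib `Representation.dual`):
`ᵗf ∘ ᵗσ(g⁻¹) = ᵗ(σ(g⁻¹) ∘ f) = ᵗ(f ∘ ρ(g⁻¹)) = ᵗρ(g⁻¹) ∘ ᵗf`.  When `V` and `W` are REFLEXIVE (`Module.IsReflexive`, e.g.
finite-dimensional vector spaces, finite free modules) the transpose is a `k`-linear BIJECTION
`Hom_G(V, W) ≅ Hom_G(W^∨, V^∨)` (injective because `W` is reflexive; surjective because an intertwiner `h : W^∨ → V^∨`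
is the transpose of `eval_W⁻¹ ∘ ᵗh ∘ eval_V`, which intertwines because `V^∨`… is separated by `W` reflexive).

* `dualTranspose ρ σ f` — `ᵗf` as an intertwining map `σ.dual → ρ.dual`; `dualTranspose_apply`;
* `dualTransposeHom ρ σ : IntertwiningMap ρ σ →ₗ[k] IntertwiningMap σ.dual ρ.dual` (linear in `f`);
* `dualTransposeHom_injective` (`W` reflexive), `dualTransposeHom_surjective` (`V`, `W` reflexive),
  **`dualTransposeEquiv ρ σ : IntertwiningMap ρ σ ≃ₗ[k] IntertwiningMap σ.dual ρ.dual`** and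
  `finrank_intertwiningMap_dual` (`dim Hom_G(W^∨, V^∨) = dim Hom_G(V, W)`).

Consumer (cell hodgecm-mathlib, fan-A line `a3-liu418` v3, step S_F «Faltings isotypic», gap (g3) of B-typ04's VI-1 check
2026-08-28): Faltings' theorem gives `Hom_{Γ_E}(V_ℓ A_K, V_ℓ A_μ)`, while the étale `H¹`-tower of
`Liu2021/AppendixC/EtaleH1Tower.lean` carries the DUALS `(V_ℓ A_K)^∨` with `Representation.dual` — this file is the dictionary.

References: [Bump1997] D. Bump, *Automorphic Forms and Representations* (1997), §4.1 p. 396 (held, read: «Let `V^*` be the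
dual space of `V` … `⟨v, π̂(g) l⟩ = ⟨π(g⁻¹) v, l⟩`», the contragredient representation = Mathlib's `Representation.dual`); the
statements below are the standard linear algebra of that definition (folklore); Mathlib `Representation.dual`,
`Module.Dual.transpose`, `Module.evalEquiv`.
-/

noncomputable section

namespace Literature.RepresentationTheory.IntertwiningDual

open Module Representation

variable {k G V W : Type*} [CommRing k] [Group G] [AddCommGroup V] [Module k V] [AddCommGroup W] [Module k W]
  (ρ : Representation k G V) (σ : Representation k G W)

/-- **The transpose of an intertwining map is intertwining for the dual representations**: for `f : V → W` with
`f ∘ ρ(g) = σ(g) ∘ f`, the dual map `ᵗf : W^∨ → V^∨` satisfies `ᵗf ∘ σ^∨(g) = ρ^∨(g) ∘ ᵗf`. [cite: Bump1997, §4.1 p. 396 (contragredient representation)] -/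
def dualTranspose (f : IntertwiningMap ρ σ) : IntertwiningMap σ.dual ρ.dual where
  toLinearMap := f.toLinearMap.dualMap
  isIntertwining' g := by
    apply LinearMap.ext
    intro φ
    apply LinearMap.ext
    intro v
    simp only [LinearMap.coe_comp, Function.comp_apply, LinearMap.dualMap_apply', Representation.dual_apply,
      Module.Dual.transpose_apply]
    change φ (σ g⁻¹ (f.toLinearMap v)) = φ (f.toLinearMap (ρ g⁻¹ v))
    rw [IntertwiningMap.toLinearMap_apply, IntertwiningMap.toLinearMap_apply, f.isIntertwining]

/-- `(ᵗf φ)(v) = φ (f v)`. [cite: Bump1997, §4.1 p. 396 (contragredient representation)] -/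
@[simp]
theorem dualTranspose_apply (f : IntertwiningMap ρ σ) (φ : Dual k W) (v : V) :
    dualTranspose ρ σ f φ v = φ (f v) :=
  rfl

/-- the underlying linear map of `ᵗf` is `f.dualMap`. [cite: Bump1997, §4.1 p. 396 (contragredient representation)] -/
theorem dualTranspose_toLinearMap (f : IntertwiningMap ρ σ) :
    (dualTranspose ρ σ f).toLinearMap = f.toLinearMap.dualMap :=
  rfl

/-- **Transposition `Hom_G(V, W) → Hom_G(W^∨, V^∨)` as a `k`-linear map.** [cite: Bump1997, §4.1 p. 396 (contragredient representation)] -/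
def dualTransposeHom : IntertwiningMap ρ σ →ₗ[k] IntertwiningMap σ.dual ρ.dual where
  toFun := dualTranspose ρ σ
  map_add' f g := by
    apply IntertwiningMap.ext
    change Module.Dual.transpose (R := k) (f.toLinearMap + g.toLinearMap) =
      Module.Dual.transpose (R := k) f.toLinearMap + Module.Dual.transpose (R := k) g.toLinearMap
    exact map_add _ _ _
  map_smul' c f := by
    apply IntertwiningMap.ext
    change Module.Dual.transpose (R := k) (c • f.toLinearMap) = c • Module.Dual.transpose (R := k) f.toLinearMap
    exact map_smul _ _ _

/-- unfolding of `dualTransposeHom`. [cite: Bump1997, §4.1 p. 396 (contragredient representation)] -/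
@[simp]
theorem dualTransposeHom_apply (f : IntertwiningMap ρ σ) : dualTransposeHom ρ σ f = dualTranspose ρ σ f :=
  rfl

/-- **Injectivity** of the transposition `Hom_G(V, W) → Hom_G(W^∨, V^∨)` (reflexive `V`, `W`: linear forms separate
points). [cite: Bump1997, §4.1 p. 396 (contragredient representation)] -/
theorem dualTransposeHom_injective [IsReflexive k V] [IsReflexive k W] :
    Function.Injective (dualTransposeHom ρ σ) := by
  intro f g hfg
  apply IntertwiningMap.ext
  have h : f.toLinearMap.dualMap = g.toLinearMap.dualMap := by
    rw [← dualTranspose_toLinearMap, ← dualTranspose_toLinearMap, ← dualTransposeHom_apply, hfg,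
      dualTransposeHom_apply]
  exact (Module.dualMap_dualMap_eq_iff (R := k) (M := V)).1 (by rw [h])

/-- For reflexive `V`: `ᵗ(eval_V) ∘ eval_{V^∨} = id` on `V^∨` (a linear form is recovered from its double-dual image).
[cite: Bump1997, §4.1 p. 396 (contragredient representation)] -/
theorem dualMap_evalEquiv_comp_eval [IsReflexive k V] :
    (evalEquiv k V).toLinearMap.dualMap ∘ₗ Dual.eval k (Dual k V) = LinearMap.id := by
  apply LinearMap.ext
  intro φ
  apply LinearMap.ext
  intro v
  simp [LinearMap.dualMap_apply', Dual.eval_apply]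

/-- For reflexive `W`: `ᵗ(eval_W⁻¹) = eval_{W^∨}` (Mathlib's `symm_dualMap_evalEquiv`, for the underlying linear map). [cite: Bump1997, §4.1 p. 396 (contragredient representation)] -/
theorem dualMap_evalEquiv_symm [IsReflexive k W] :
    (evalEquiv k W).symm.toLinearMap.dualMap = Dual.eval k (Dual k W) := by
  apply LinearMap.ext
  intro φ
  apply LinearMap.ext
  intro f
  simp [LinearMap.dualMap_apply', Dual.eval_apply]

/-- **The inverse construction**: for reflexive `V`, `W` and an intertwiner `h : W^∨ → V^∨` of the duals, the map
`eval_W⁻¹ ∘ ᵗh ∘ eval_V : V → W` has transpose `h`. [cite: Bump1997, §4.1 p. 396 (contragredient representation)] -/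
theorem dualMap_detranspose [IsReflexive k V] [IsReflexive k W] (h : Dual k W →ₗ[k] Dual k V) :
    ((evalEquiv k W).symm.toLinearMap ∘ₗ h.dualMap ∘ₗ (evalEquiv k V).toLinearMap).dualMap = h := by
  rw [← LinearMap.dualMap_comp_dualMap, ← LinearMap.dualMap_comp_dualMap, dualMap_evalEquiv_symm,
    LinearMap.comp_assoc, Dual.eval_naturality h, ← LinearMap.comp_assoc, dualMap_evalEquiv_comp_eval,
    LinearMap.id_comp]

/-- The de-transposed map `eval_W⁻¹ ∘ ᵗh ∘ eval_V` of an intertwiner `h : W^∨ → V^∨` of the duals intertwines `ρ` and `σ`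
(reflexive `V`, `W`): checked after transposition, where it reads `h ∘ σ^∨(g⁻¹) = ρ^∨(g⁻¹) ∘ h`. [cite: Bump1997, §4.1 p. 396 (contragredient representation)] -/
def detranspose [IsReflexive k V] [IsReflexive k W] (h : IntertwiningMap σ.dual ρ.dual) : IntertwiningMap ρ σ where
  toLinearMap := (evalEquiv k W).symm.toLinearMap ∘ₗ h.toLinearMap.dualMap ∘ₗ (evalEquiv k V).toLinearMap
  isIntertwining' g := by
    -- `h` intertwines the duals at `g⁻¹`: `h ∘ ᵗσ(g) = ᵗρ(g) ∘ h`
    have hh : h.toLinearMap ∘ₗ (σ g).dualMap = (ρ g).dualMap ∘ₗ h.toLinearMap := by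
      have := h.isIntertwining' g⁻¹
      simp only [Representation.dual_apply, inv_inv] at this
      exact this
    set F : V →ₗ[k] W := (evalEquiv k W).symm.toLinearMap ∘ₗ h.toLinearMap.dualMap ∘ₗ (evalEquiv k V).toLinearMap
      with hF
    have hFt : F.dualMap = h.toLinearMap := by
      rw [hF]
      exact dualMap_detranspose h.toLinearMap
    clear_value F
    -- compare transposes (injective since `W` is reflexive)
    apply (Module.dualMap_dualMap_eq_iff (R := k) (M := V)).1
    apply congrArg LinearMap.dualMap
    rw [← LinearMap.dualMap_comp_dualMap, ← LinearMap.dualMap_comp_dualMap, hFt, hh]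

/-- the underlying linear map of `detranspose h`. [cite: Bump1997, §4.1 p. 396 (contragredient representation)] -/
theorem detranspose_toLinearMap [IsReflexive k V] [IsReflexive k W] (h : IntertwiningMap σ.dual ρ.dual) :
    (detranspose ρ σ h).toLinearMap =
      (evalEquiv k W).symm.toLinearMap ∘ₗ h.toLinearMap.dualMap ∘ₗ (evalEquiv k V).toLinearMap :=
  rfl

/-- `ᵗ(detranspose h) = h`. [cite: Bump1997, §4.1 p. 396 (contragredient representation)] -/
theorem dualTranspose_detranspose [IsReflexive k V] [IsReflexive k W] (h : IntertwiningMap σ.dual ρ.dual) :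
    dualTranspose ρ σ (detranspose ρ σ h) = h := by
  apply IntertwiningMap.ext
  rw [dualTranspose_toLinearMap, detranspose_toLinearMap, dualMap_detranspose]

/-- **Surjectivity** of the transposition for reflexive `V`, `W`. [cite: Bump1997, §4.1 p. 396 (contragredient representation)] -/
theorem dualTransposeHom_surjective [IsReflexive k V] [IsReflexive k W] :
    Function.Surjective (dualTransposeHom ρ σ) :=
  fun h => ⟨detranspose ρ σ h, dualTranspose_detranspose ρ σ h⟩

/-- **`Hom_G(V, W) ≃ Hom_G(W^∨, V^∨)` by transposition**, for reflexive `V`, `W` (finite-dimensional vector spaces, finite free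
modules). [cite: Bump1997, §4.1 p. 396 (contragredient representation)] -/
def dualTransposeEquiv [IsReflexive k V] [IsReflexive k W] : IntertwiningMap ρ σ ≃ₗ[k] IntertwiningMap σ.dual ρ.dual :=
  LinearEquiv.ofBijective (dualTransposeHom ρ σ) ⟨dualTransposeHom_injective ρ σ, dualTransposeHom_surjective ρ σ⟩

/-- unfolding of `dualTransposeEquiv`. [cite: Bump1997, §4.1 p. 396 (contragredient representation)] -/
@[simp]
theorem dualTransposeEquiv_apply [IsReflexive k V] [IsReflexive k W] (f : IntertwiningMap ρ σ) :
    dualTransposeEquiv ρ σ f = dualTranspose ρ σ f :=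
  rfl

/-- **`dim_k Hom_G(W^∨, V^∨) = dim_k Hom_G(V, W)`** (reflexive `V`, `W`). [cite: Bump1997, §4.1 p. 396 (contragredient representation)] -/
theorem finrank_intertwiningMap_dual [IsReflexive k V] [IsReflexive k W] :
    Module.finrank k (IntertwiningMap σ.dual ρ.dual) = Module.finrank k (IntertwiningMap ρ σ) :=
  (LinearEquiv.finrank_eq (dualTransposeEquiv ρ σ)).symm

end Literature.RepresentationTheory.IntertwiningDual

end
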